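import Literature.MathematicalPhysics.QuantumLattice.InfVolFermionStateTorusLimitTwoSectorCompanionEnergyWindow
import HarnessLib

/-!
# Energy-window rows of the PAIR companion `(k_L − 1, k_L − 1)` of the thermal object of record, and the
# record's N2′ cap for ANY companion family linked by a convergent partition-function ratio

Topic `Literature/MathematicalPhysics/QuantumLattice`; complement of
`InfVolFermionStateTorusLimitTwoSectorCompanionEnergyWindow.lean` (the same rows for the «rm↑» companion
`(k_L − 1, k_L)`) and of `…TwoSectorCompanionChain.lean` (existence of the pair companion by chaining; the «rm↓»
rows between the two companions). The PAIR companion `ω''` — torus limit of the canonical states of the sectors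
`(k_L − 1, k_L − 1)` (`S^z = 0`, one pair removed), the image of the pair templates `c_{x↑}c_{y↓}` — is the one the
superconducting-correlation rows of a thermal relaxation talk to. For the thermal object of record `ω` along
`Ls → ∞` (`0 < n < 2`) and ANY such `ω''` along the same `Ls`:

* §2 `…exists_tendsto_partitionFn_ratio_pos_of_pairCompanion`: `Z_{(k−1,k−1)}/Z_{(k,k)} → r > 0` along a
  subsequence (an intermediate `(k_L − 1, k_L)` companion exists by `…exists_twoSector_predCompanion_of_sectorGibbs`;
  for the given pair `(ω', ω'')` the single-step ratio converges along a further subsequence —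
  `…exists_tendsto_partitionFn_ratio_pos_pair_of_pred`, Bolzano–Weierstrass for `u = r/(1+r)` and the «rm↓» rows
  with vanishing fugacity term, `x = Re ω'(n_{0↓}) = n/2`, `y' = 1 − Re ω''(n_{0↓}) = 1 − n/2 — and
  `Z''/Z = (Z''/Z')(Z'/Z)`);
* §3 by name (`β > 0`): `e_Φ(ω'') ≤ e_Φ(ω) + 2H_b(n/2)/β`, `e_Φ(ω) ≤ e_Φ(ω'') + 2H_b(n/2)/β`, the FLOOR
  `e(n) ≤ e_Φ(ω'')` (`U ≥ 0`; translation invariance, density `n/2 + n/2`);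
* §4 `…meanEnergy_companion_le_energyDensityTT'_add_of_partitionRatio` (abstract companion family `P'`, any
  presentation, `Z_{P'}/Z_{(k,k)} → r > 0`, `log #P' ≤ sL²`): `e_Φ(ω') ≤ e(n) + s/β` (`F ≤ E₀`, `E₀/L² → e(n)`);
  hence the pair companion's CAP `e_Φ(ω'') ≤ e(n) + 2H_b(n/2)/β` and the window
  `…meanEnergy_pairCompanion_mem_Icc_energyDensityTT'` — the record N2′ window VERBATIM;
* §1 bookkeeping: entropy of the pair sector (`2H_b(n/2)`), its up-spin density, positivity of the single-step
  ratio.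

HONEST SCOPE: thermal energy windows only; pairs of states along a common `Ls`; no uniqueness, no `ω'' = ω`, no
number. Everything is PROVED; no definition, no named fact.

## Mathlib / tree search

REUSED: `IsTorusLimitOfMixture.meanEnergy_le_meanEnergy_add_of_partitionRatio`, `mul_gibbsMean_le_level_of_partitionRatio`,
`sum_presentation_mul_re_expect_eq_gibbsMean` (`TorusGibbsTwoSectorFreeEnergyComparison`);
`exists_sectorEigenvalue_szConfig_le_groundEnergy`, `log_card_subtype_spinConfig_le_binEntropy`
(`…CompanionEnergyWindow`); `…exists_twoSector_predCompanion_of_sectorGibbs` (`…CompanionExistence`);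
`…re_expect_twoSector_eeb_annihilation_down_nonneg_of_predCompanion`, `…creation_down_reverse_nonneg_of_pairCompanion`,
`…re_expect_nAt_down_eq_half_of_predCompanion/pairCompanion` (`…CompanionChain`); `not_forall_linear_rows_zero`;
`tendsto_energyDensityTT'_torus`, `eventually_log_sectorGibbsCount_le`,
`energyDensityTT'_le_meanEnergy_of_isTranslationInvariant`; Mathlib `tendsto_subseq_of_bounded`,
`Real.binEntropy_continuous`. `lean search 'pairCompanion_le|pairCompanion_mem'`: nothing (2026-08-27).

## References

* R. B. Israel, *Convexity in the Theory of Lattice Gases* (1979), Lemma II.3.1. [cite: Israel1979, Lemma II.3.1]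
* D. Ruelle, *Statistical Mechanics: Rigorous Results* (1969), §3.4. [cite: Ruelle1969, §3.4]
* O. Bratteli, D. W. Robinson, *OAQSM 1* (1987), Thm. 2.3.15; *OAQSM 2* (1997), §5.4.2.
  [cite: BratteliRobinsonI1987, Thm. 2.3.15 (weak-⋆ compactness of the state space) and §4.3.1]
  [cite: BratteliRobinsonII1997, §5.4.2]
* H. Fawzi, O. Fawzi, S. O. Scalet (2024), Thm. 3.1. [cite: FawziFawziScalet2024, Thm. 3.1]
* E. H. Lieb, Phys. Rev. Lett. 62 (1989) 1201, eq. (2). [cite: LiebPRL1989, eq. (2)]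
-/

noncomputable section

namespace Literature.MathematicalPhysics.QuantumLattice

open Matrix Finset HubbardWave0 Literature.Probability.LatticeModels ThermodynamicLimit
open _root_.Filter
open scoped _root_.Topology ComplexOrder BigOperators

/-! ### §1 Bookkeeping: entropy and densities of the pair sector -/

section Bookkeeping

/-- **Eventually `log #(k_L − 1, k_L − 1) ≤ s·L²` along `Ls → ∞` for every `s > 2H_b(n/2)`** (`0 ≤ n ≤ 2`).
[cite: Israel1979, Lemma II.3.1] -/
theorem eventually_log_card_spinConfig_pairCompanion_le {n : ℝ} (hn0 : 0 ≤ n) (hn2 : n ≤ 2) {Ls : ℕ → ℕ}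
    (hLs : Tendsto Ls atTop atTop) {s : ℝ} (hs : 2 * Real.binEntropy (n / 2) < s) :
    ∀ᶠ j in atTop, Real.log (Fintype.card (Subtype (spinConfig (Λ := FermionTorus 2 (Ls j))
      (halfRectN n (Ls j) - 1) (halfRectN n (Ls j) - 1)))) ≤ s * (Ls j : ℝ) ^ 2 := by
  have hcont : Tendsto (fun j => Real.binEntropy (((halfRectN n (Ls j) - 1 : ℕ) : ℝ) / (Ls j : ℝ) ^ 2) +
      Real.binEntropy (((halfRectN n (Ls j) - 1 : ℕ) : ℝ) / (Ls j : ℝ) ^ 2)) atTop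
      (𝓝 (Real.binEntropy (n / 2) + Real.binEntropy (n / 2))) :=
    ((Real.binEntropy_continuous.tendsto _).comp (tendsto_halfRectN_pred_div_sq_comp hn0 hLs)).add
      ((Real.binEntropy_continuous.tendsto _).comp (tendsto_halfRectN_pred_div_sq_comp hn0 hLs))
  rw [← two_mul] at hcont
  filter_upwards [hcont.eventually (gt_mem_nhds hs)] with j hj
  have hL2 : (0 : ℝ) ≤ (Ls j : ℝ) ^ 2 := sq_nonneg _
  have hk : halfRectN n (Ls j) - 1 ≤ Ls j * Ls j := (Nat.sub_le _ _).trans (halfRectN_le_mul_self hn0 hn2 (Ls j))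
  calc Real.log (Fintype.card (Subtype (spinConfig (Λ := FermionTorus 2 (Ls j))
        (halfRectN n (Ls j) - 1) (halfRectN n (Ls j) - 1))))
      ≤ (Ls j : ℝ) ^ 2 * (Real.binEntropy (((halfRectN n (Ls j) - 1 : ℕ) : ℝ) / (Ls j : ℝ) ^ 2) +
          Real.binEntropy (((halfRectN n (Ls j) - 1 : ℕ) : ℝ) / (Ls j : ℝ) ^ 2)) :=
        log_card_subtype_spinConfig_le_binEntropy (Ls j) hk hk
    _ ≤ (Ls j : ℝ) ^ 2 * s := mul_le_mul_of_nonneg_left hj.le hL2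
    _ = s * (Ls j : ℝ) ^ 2 := mul_comm _ _

namespace InfVolFermionState

/-- **Up-spin density of the pair companion `(k_L − 1, k_L − 1)`**: `Re ω''(n_{0↑}) = n/2` (`0 ≤ n ≤ 2`).
[cite: Ruelle1969, §3.4] [cite: LiebPRL1989, eq. (2)] -/
theorem IsTorusLimitOfMixture.re_expect_nAt_up_eq_half_of_pairCompanion (t t' U β : ℝ) {n : ℝ}
    (hn0 : 0 ≤ n) (hn2 : n ≤ 2) {Ls : ℕ → ℕ} (hLs : Tendsto Ls atTop atTop) {ω'' : InfVolFermionState 2}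
    (hω'' : ω''.IsTorusLimitOfMixture
      (fun L => Fintype.card (Subtype (spinConfig (Λ := FermionTorus 2 L) (halfRectN n L - 1) (halfRectN n L - 1))))
      (fun L i => canonicalWeight β (sectorEigenvalue (spinConfig (halfRectN n L - 1) (halfRectN n L - 1))
        (hubbardTorusTT' L t t' U) (hubbardTorusTT'_isHermitian L t t' U)) ((Fintype.equivFin _).symm i))
      (fun L i => sectorEigenvector (spinConfig (halfRectN n L - 1) (halfRectN n L - 1)) (hubbardTorusTT' L t t' U)
        (hubbardTorusTT'_isHermitian L t t' U) ((Fintype.equivFin _).symm i)) Ls) :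
    (ω''.expect {0} (nAt 0 (Finset.mem_singleton_self 0) 0)).re = n / 2 :=
  (hω''.re_expect_nAt_eq_of_spinSectorGibbs t t' U β (fun L => halfRectN n L - 1) (fun L => halfRectN n L - 1)
    (fun _ => (Fintype.equivFin _).symm) (fun _ _ => rfl) (fun _ _ => rfl) hLs
    (Eventually.of_forall fun j =>
      ⟨(Nat.sub_le _ _).trans (halfRectN_le_mul_self hn0 hn2 (Ls j)),
        (Nat.sub_le _ _).trans (halfRectN_le_mul_self hn0 hn2 (Ls j))⟩)).1
    (tendsto_halfRectN_pred_div_sq_comp hn0 hLs)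

end InfVolFermionState

/-- The ratio `Z_{(k−1,k−1)}(L)/Z_{(k−1,k)}(L)` is positive (`0 ≤ n ≤ 2`). [cite: Israel1979, Lemma II.3.1] -/
theorem partitionFn_ratio_pair_pred_pos (t t' U β : ℝ) {n : ℝ} (hn0 : 0 ≤ n) (hn2 : n ≤ 2) (L : ℕ) :
    0 < (∑ d, Real.exp (-(β * sectorEigenvalue (spinConfig (halfRectN n L - 1) (halfRectN n L - 1))
        (hubbardTorusTT' L t t' U) (hubbardTorusTT'_isHermitian L t t' U) d))) /
      (∑ c, Real.exp (-(β * sectorEigenvalue (spinConfig (halfRectN n L - 1) (halfRectN n L))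
        (hubbardTorusTT' L t t' U) (hubbardTorusTT'_isHermitian L t t' U) c))) := by
  obtain ⟨s₂, hs₂⟩ := exists_spinConfig_of_le L ((Nat.sub_le _ _).trans (halfRectN_le_mul_self hn0 hn2 L))
    ((Nat.sub_le _ _).trans (halfRectN_le_mul_self hn0 hn2 L))
  haveI : Nonempty (Subtype (spinConfig (Λ := FermionTorus 2 L) (halfRectN n L - 1) (halfRectN n L - 1))) :=
    ⟨⟨s₂, hs₂⟩⟩
  obtain ⟨s₁, hs₁⟩ := exists_spinConfig_of_le L ((Nat.sub_le _ _).trans (halfRectN_le_mul_self hn0 hn2 L))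
    (halfRectN_le_mul_self hn0 hn2 L)
  haveI : Nonempty (Subtype (spinConfig (Λ := FermionTorus 2 L) (halfRectN n L - 1) (halfRectN n L))) := ⟨⟨s₁, hs₁⟩⟩
  exact div_pos (Finset.sum_pos (fun _ _ => Real.exp_pos _) Finset.univ_nonempty)
    (Finset.sum_pos (fun _ _ => Real.exp_pos _) Finset.univ_nonempty)

end Bookkeeping

/-! ### §2 For a GIVEN pair `(ω, ω'')`: the ratio `Z_{(k−1,k−1)}/Z_{(k,k)}` converges to a positive number along
a subsequence -/

section Ratio

variable (t t' U β : ℝ)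

/-- `0 ≤ r/(1+r) ≤ 1` for `0 ≤ r`. [folklore] -/
private theorem div_one_add_mem_Icc'' {r : ℝ} (hr : 0 ≤ r) : r / (1 + r) ∈ Set.Icc (0 : ℝ) 1 :=
  ⟨div_nonneg hr (by positivity), (div_le_one (by positivity)).2 (by linarith)⟩

/-- If `r_j/(1+r_j) → u < 1` then `r_j → u/(1−u)` (`r_j ≥ 0`). [folklore] -/
private theorem tendsto_of_tendsto_div_one_add'' {r : ℕ → ℝ} (hr : ∀ j, 0 ≤ r j) {u : ℝ} (hu1 : u < 1)
    (hu : Tendsto (fun j => r j / (1 + r j)) atTop (𝓝 u)) :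
    Tendsto r atTop (𝓝 (u / (1 - u))) := by
  have h : Tendsto (fun j => r j / (1 + r j) / (1 - r j / (1 + r j))) atTop (𝓝 (u / (1 - u))) :=
    hu.div (tendsto_const_nhds.sub hu) (by linarith)
  refine h.congr fun j => ?_
  have h1 : (1 + r j) ≠ 0 := by linarith [hr j]
  have h2 : 1 - r j / (1 + r j) = 1 / (1 + r j) := by field_simp; ring
  rw [h2]
  field_simp

/-- If `r_j/(1+r_j) → 1` then `r_j⁻¹ → 0` (`r_j > 0`). [folklore] -/
private theorem tendsto_inv_of_tendsto_div_one_add'' {r : ℕ → ℝ} (hr : ∀ j, 0 < r j)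
    (hu : Tendsto (fun j => r j / (1 + r j)) atTop (𝓝 1)) :
    Tendsto (fun j => (r j)⁻¹) atTop (𝓝 0) := by
  have h : Tendsto (fun j => (1 - r j / (1 + r j)) / (r j / (1 + r j))) atTop (𝓝 ((1 - 1) / 1)) :=
    (tendsto_const_nhds.sub hu).div hu one_ne_zero
  rw [sub_self, zero_div] at h
  refine h.congr fun j => ?_
  have h1 : (1 + r j) ≠ 0 := by linarith [hr j]
  have h2 : 1 - r j / (1 + r j) = 1 / (1 + r j) := by field_simp; ring
  rw [h2]
  field_simp

/-- **For a GIVEN pair `(ω', ω'')` of companions the single-step ratio `Z_{(k−1,k−1)}/Z_{(k−1,k)}` converges to a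
positive number along a subsequence.** `ω'` a torus limit along `Ls → ∞` of the canonical states of
`(k_L − 1, k_L)`, `ω''` one of `(k_L − 1, k_L − 1)` along the same `Ls` (`0 < n < 2`): Bolzano–Weierstrass for
`u = r/(1+r)` and the «rm↓» rows between the companions (`x`-moment `Re ω'(n_{0↓}) = n/2`, `y'`-moment
`1 − Re ω''(n_{0↓}) = 1 − n/2`) with vanishing fugacity term. [cite: BratteliRobinsonII1997, §5.4.2]
[cite: FawziFawziScalet2024, Thm. 3.1] -/
theorem InfVolFermionState.IsTorusLimitOfMixture.exists_tendsto_partitionFn_ratio_pos_pair_of_pred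
    {n : ℝ} (hn0 : 0 < n) (hn2 : n < 2) {Ls : ℕ → ℕ} (hLs : Tendsto Ls atTop atTop)
    {ω' ω'' : InfVolFermionState 2}
    (hω' : ω'.IsTorusLimitOfMixture
      (fun L => Fintype.card (Subtype (spinConfig (Λ := FermionTorus 2 L) (halfRectN n L - 1) (halfRectN n L))))
      (fun L i => canonicalWeight β (sectorEigenvalue (spinConfig (halfRectN n L - 1) (halfRectN n L))
        (hubbardTorusTT' L t t' U) (hubbardTorusTT'_isHermitian L t t' U)) ((Fintype.equivFin _).symm i))
      (fun L i => sectorEigenvector (spinConfig (halfRectN n L - 1) (halfRectN n L)) (hubbardTorusTT' L t t' U)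
        (hubbardTorusTT'_isHermitian L t t' U) ((Fintype.equivFin _).symm i)) Ls)
    (hω'' : ω''.IsTorusLimitOfMixture
      (fun L => Fintype.card (Subtype (spinConfig (Λ := FermionTorus 2 L) (halfRectN n L - 1) (halfRectN n L - 1))))
      (fun L i => canonicalWeight β (sectorEigenvalue (spinConfig (halfRectN n L - 1) (halfRectN n L - 1))
        (hubbardTorusTT' L t t' U) (hubbardTorusTT'_isHermitian L t t' U)) ((Fintype.equivFin _).symm i))
      (fun L i => sectorEigenvector (spinConfig (halfRectN n L - 1) (halfRectN n L - 1)) (hubbardTorusTT' L t t' U)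
        (hubbardTorusTT'_isHermitian L t t' U) ((Fintype.equivFin _).symm i)) Ls) :
    ∃ φ : ℕ → ℕ, StrictMono φ ∧ ∃ r : ℝ, 0 < r ∧
      Tendsto (fun j =>
        (∑ d, Real.exp (-(β * sectorEigenvalue (spinConfig (halfRectN n (Ls (φ j)) - 1) (halfRectN n (Ls (φ j)) - 1))
            (hubbardTorusTT' (Ls (φ j)) t t' U) (hubbardTorusTT'_isHermitian (Ls (φ j)) t t' U) d))) /
          (∑ c, Real.exp (-(β * sectorEigenvalue (spinConfig (halfRectN n (Ls (φ j)) - 1) (halfRectN n (Ls (φ j))))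
            (hubbardTorusTT' (Ls (φ j)) t t' U) (hubbardTorusTT'_isHermitian (Ls (φ j)) t t' U) c)))) atTop (𝓝 r) := by
  have hn0' : 0 ≤ n := hn0.le
  have hn2' : n ≤ 2 := hn2.le
  set R : ℕ → ℝ := fun L =>
    (∑ d, Real.exp (-(β * sectorEigenvalue (spinConfig (halfRectN n L - 1) (halfRectN n L - 1))
        (hubbardTorusTT' L t t' U) (hubbardTorusTT'_isHermitian L t t' U) d))) /
      (∑ c, Real.exp (-(β * sectorEigenvalue (spinConfig (halfRectN n L - 1) (halfRectN n L))
        (hubbardTorusTT' L t t' U) (hubbardTorusTT'_isHermitian L t t' U) c))) with hR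
  have hRpos : ∀ L, 0 < R L := fun L => partitionFn_ratio_pair_pred_pos t t' U β hn0' hn2' L
  have humem : ∀ j, R (Ls j) / (1 + R (Ls j)) ∈ Set.Icc (0 : ℝ) 1 := fun j =>
    div_one_add_mem_Icc'' (hRpos _).le
  obtain ⟨u, hu, φ, hφ, hlim⟩ := tendsto_subseq_of_bounded (Metric.isBounded_Icc 0 1) humem
  rw [isClosed_Icc.closure_eq] at hu
  have hLsφ : Tendsto (Ls ∘ φ) atTop atTop := hLs.comp hφ.tendsto_atTop
  have hω'φ := hω'.comp_tendsto hφ.tendsto_atTop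
  have hω''φ := hω''.comp_tendsto hφ.tendsto_atTop
  have hlim' : Tendsto (fun j => R (Ls (φ j)) / (1 + R (Ls (φ j)))) atTop (𝓝 u) := hlim
  -- the two one-site densities
  have hxeq : (ω'.expect (thicken ({0} : Finset (Site 2)) 1)
      ((fermionEmbed (PolySite.incl (subset_thicken {0} 1))
          (annihilation (orb (PolySite.pt (0 : Site 2) (Finset.mem_singleton_self 0)) 1)))ᴴ *
        fermionEmbed (PolySite.incl (subset_thicken {0} 1))
          (annihilation (orb (PolySite.pt (0 : Site 2) (Finset.mem_singleton_self 0)) 1)))).re = n / 2 := by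
    rw [hω'φ.isTranslationInvariant.expect_conjTranspose_mul_fermionEmbed_incl_cAt,
      hω'φ.re_expect_nAt_down_eq_half_of_predCompanion t t' U β hn0' hn2' hLsφ]
  have hyeq : (ω''.expect (thicken ({0} : Finset (Site 2)) 1)
      (fermionEmbed (PolySite.incl (subset_thicken {0} 1))
          (annihilation (orb (PolySite.pt (0 : Site 2) (Finset.mem_singleton_self 0)) 1)) *
        (fermionEmbed (PolySite.incl (subset_thicken {0} 1))
          (annihilation (orb (PolySite.pt (0 : Site 2) (Finset.mem_singleton_self 0)) 1)))ᴴ)).re = 1 - n / 2 := by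
    rw [hω''φ.isTranslationInvariant.expect_fermionEmbed_incl_cAt_mul_conjTranspose, Complex.sub_re, Complex.one_re,
      hω''φ.re_expect_nAt_down_eq_half_of_pairCompanion t t' U β hn0' hn2' hLsφ]
  -- `u ≠ 0`: the «rm↓» rows with a vanishing fugacity term
  have hu0 : u ≠ 0 := by
    rintro rfl
    have hr0 : Tendsto (fun j => R (Ls (φ j))) atTop (𝓝 0) := by
      have h := tendsto_of_tendsto_div_one_add'' (fun j => (hRpos (Ls (φ j))).le) zero_lt_one hlim'
      rwa [zero_div] at h
    exact not_forall_linear_rows_zero (half_pos hn0) fun s q hq => by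
      have h := hω'φ.re_expect_twoSector_eeb_annihilation_down_nonneg_of_predCompanion t t' U β hn0 hLsφ hω''φ hr0
        (Λ := {0}) (x := 0) (Finset.mem_singleton_self 0) hq
      rw [hxeq] at h
      exact h
  -- `u ≠ 1`: the reversed rows (inverse ratio `→ 0`)
  have hu1 : u ≠ 1 := by
    rintro rfl
    have hr0 : Tendsto (fun j =>
        (∑ c, Real.exp (-(β * sectorEigenvalue (spinConfig (halfRectN n (Ls (φ j)) - 1) (halfRectN n (Ls (φ j))))
            (hubbardTorusTT' (Ls (φ j)) t t' U) (hubbardTorusTT'_isHermitian (Ls (φ j)) t t' U) c))) /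
          ∑ d, Real.exp (-(β * sectorEigenvalue (spinConfig (halfRectN n (Ls (φ j)) - 1) (halfRectN n (Ls (φ j)) - 1))
            (hubbardTorusTT' (Ls (φ j)) t t' U) (hubbardTorusTT'_isHermitian (Ls (φ j)) t t' U) d))) atTop (𝓝 0) := by
      have h := tendsto_inv_of_tendsto_div_one_add'' (fun j => hRpos (Ls (φ j))) hlim'
      refine h.congr fun j => ?_
      rw [hR, inv_div]
    have hy0 : 0 < 1 - n / 2 := by linarith
    exact not_forall_linear_rows_zero hy0 fun s q hq => by
      have h := hω'φ.re_expect_twoSector_eeb_creation_down_reverse_nonneg_of_pairCompanion t t' U β hn0 hLsφ hω''φ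
        hr0 (Λ := {0}) (x := 0) (Finset.mem_singleton_self 0) hq
      rw [← annihilation_conjTranspose, fermionEmbed_conjTranspose, conjTranspose_conjTranspose, hyeq] at h
      exact h
  have hu0' : 0 < u := lt_of_le_of_ne hu.1 (Ne.symm hu0)
  have hu1' : u < 1 := lt_of_le_of_ne hu.2 hu1
  exact ⟨φ, hφ, u / (1 - u), div_pos hu0' (by linarith),
    tendsto_of_tendsto_div_one_add'' (fun j => (hRpos (Ls (φ j))).le) hu1' hlim'⟩

/-- **For a GIVEN pair `(ω, ω'')` the pair ratio `Z_{(k−1,k−1)}/Z_{(k,k)}` converges to a positive number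
along a subsequence.** `ω` the thermal object of record along `Ls → ∞` (`0 < n < 2`), `ω''` ANY torus limit
along the same `Ls` of the canonical states of the pair sectors `(k_L − 1, k_L − 1)`: an intermediate
`(k_L − 1, k_L)` companion exists along a subsequence (`…exists_twoSector_predCompanion_of_sectorGibbs`, ratio
`→ r₁ > 0`), the single-step ratio from it to `ω''` converges along a further subsequence (`→ r₂ > 0`), and
`Z''/Z = (Z''/Z')(Z'/Z) → r₁r₂`. [cite: BratteliRobinsonII1997, §5.4.2] [cite: FawziFawziScalet2024, Thm. 3.1]
[cite: BratteliRobinsonI1987, Thm. 2.3.15 (weak-⋆ compactness of the state space) and §4.3.1] -/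
theorem InfVolFermionState.IsTorusLimitOfMixture.exists_tendsto_partitionFn_ratio_pos_of_pairCompanion
    {n : ℝ} (hn0 : 0 < n) (hn2 : n < 2) {Ls : ℕ → ℕ} (hLs : Tendsto Ls atTop atTop)
    {ω ω'' : InfVolFermionState 2}
    (hω : ω.IsTorusLimitOfMixture (sectorGibbsCount n) (fun L => sectorGibbsWeightTT' β t t' U n L)
      (fun L => sectorGibbsVectorTT' t t' U n L) Ls)
    (hω'' : ω''.IsTorusLimitOfMixture
      (fun L => Fintype.card (Subtype (spinConfig (Λ := FermionTorus 2 L) (halfRectN n L - 1) (halfRectN n L - 1))))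
      (fun L i => canonicalWeight β (sectorEigenvalue (spinConfig (halfRectN n L - 1) (halfRectN n L - 1))
        (hubbardTorusTT' L t t' U) (hubbardTorusTT'_isHermitian L t t' U)) ((Fintype.equivFin _).symm i))
      (fun L i => sectorEigenvector (spinConfig (halfRectN n L - 1) (halfRectN n L - 1)) (hubbardTorusTT' L t t' U)
        (hubbardTorusTT'_isHermitian L t t' U) ((Fintype.equivFin _).symm i)) Ls) :
    ∃ φ : ℕ → ℕ, StrictMono φ ∧ ∃ r : ℝ, 0 < r ∧
      Tendsto (fun j =>
        (∑ d, Real.exp (-(β * sectorEigenvalue (spinConfig (halfRectN n (Ls (φ j)) - 1) (halfRectN n (Ls (φ j)) - 1))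
            (hubbardTorusTT' (Ls (φ j)) t t' U) (hubbardTorusTT'_isHermitian (Ls (φ j)) t t' U) d))) /
          (∑ c, Real.exp (-(β * sectorEigenvalue (szConfig n (Ls (φ j))) (hubbardTorusTT' (Ls (φ j)) t t' U)
            (hubbardTorusTT'_isHermitian (Ls (φ j)) t t' U) c)))) atTop (𝓝 r) := by
  have hn0' : 0 ≤ n := hn0.le
  have hn2' : n ≤ 2 := hn2.le
  -- an intermediate companion on `(k − 1, k)`
  obtain ⟨φ₁, hφ₁, ω', r₁, hr₁0, -, hω', hr₁⟩ :=
    hω.exists_twoSector_predCompanion_of_sectorGibbs t t' U β hn0 hn2 hLs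
  have hLs₁ : Tendsto (Ls ∘ φ₁) atTop atTop := hLs.comp hφ₁.tendsto_atTop
  -- the single-step ratio for the given pair `(ω', ω'')` along `Ls ∘ φ₁`
  obtain ⟨φ₂, hφ₂, r₂, hr₂0, hr₂⟩ :=
    hω'.exists_tendsto_partitionFn_ratio_pos_pair_of_pred t t' U β hn0 hn2 hLs₁ (hω''.comp_tendsto hφ₁.tendsto_atTop)
  have hr₁' := hr₁.comp hφ₂.tendsto_atTop
  refine ⟨fun j => φ₁ (φ₂ j), hφ₁.comp hφ₂, r₁ * r₂, mul_pos hr₁0 hr₂0, ?_⟩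
  refine (hr₁'.mul hr₂).congr fun j => ?_
  have hZ : (∑ c, Real.exp (-(β * sectorEigenvalue
      (spinConfig (halfRectN n (Ls (φ₁ (φ₂ j))) - 1) (halfRectN n (Ls (φ₁ (φ₂ j)))))
      (hubbardTorusTT' (Ls (φ₁ (φ₂ j))) t t' U) (hubbardTorusTT'_isHermitian (Ls (φ₁ (φ₂ j))) t t' U) c))) ≠ 0 := by
    obtain ⟨s, hs⟩ := exists_spinConfig_of_le (Ls (φ₁ (φ₂ j)))
      ((Nat.sub_le _ _).trans (halfRectN_le_mul_self hn0' hn2' _)) (halfRectN_le_mul_self hn0' hn2' _)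
    haveI : Nonempty (Subtype (spinConfig (Λ := FermionTorus 2 (Ls (φ₁ (φ₂ j))))
      (halfRectN n (Ls (φ₁ (φ₂ j))) - 1) (halfRectN n (Ls (φ₁ (φ₂ j)))))) := ⟨⟨s, hs⟩⟩
    exact (Finset.sum_pos (fun _ _ => Real.exp_pos _) Finset.univ_nonempty).ne'
  have key : ∀ a b c : ℝ, b ≠ 0 → b / c * (a / b) = a / c := fun a b c hb => by
    rw [div_mul_div_comm, mul_comm b a, mul_div_mul_right _ _ hb]
  simp only [Function.comp_apply]
  exact key _ _ _ hZ

end Ratio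

/-! ### §3 Energy-window rows of the pair companion, by name -/

section Windows

variable (t t' U β : ℝ)

/-- **The pair companion's mean energy is within `2H_b(n/2)/β` of the object of record's (upper side)**
(`β > 0`, `0 < n < 2`; no sign of `U`): `e_Φ(ω'') ≤ e_Φ(ω) + 2·H_b(n/2)/β`. [cite: Israel1979, Lemma II.3.1]
[cite: BratteliRobinsonII1997, §5.4.2] [cite: Ruelle1969, §3.4] -/
theorem InfVolFermionState.IsTorusLimitOfMixture.meanEnergy_pairCompanion_le_meanEnergy_add
    (hβ : 0 < β) {n : ℝ} (hn0 : 0 < n) (hn2 : n < 2) {Ls : ℕ → ℕ} (hLs : Tendsto Ls atTop atTop)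
    {ω ω'' : InfVolFermionState 2}
    (hω : ω.IsTorusLimitOfMixture (sectorGibbsCount n) (fun L => sectorGibbsWeightTT' β t t' U n L)
      (fun L => sectorGibbsVectorTT' t t' U n L) Ls)
    (hω'' : ω''.IsTorusLimitOfMixture
      (fun L => Fintype.card (Subtype (spinConfig (Λ := FermionTorus 2 L) (halfRectN n L - 1) (halfRectN n L - 1))))
      (fun L i => canonicalWeight β (sectorEigenvalue (spinConfig (halfRectN n L - 1) (halfRectN n L - 1))
        (hubbardTorusTT' L t t' U) (hubbardTorusTT'_isHermitian L t t' U)) ((Fintype.equivFin _).symm i))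
      (fun L i => sectorEigenvector (spinConfig (halfRectN n L - 1) (halfRectN n L - 1)) (hubbardTorusTT' L t t' U)
        (hubbardTorusTT'_isHermitian L t t' U) ((Fintype.equivFin _).symm i)) Ls) :
    ω''.meanEnergy (hubbardTTPrimeFermionInteraction t t' U) 1 ≤
      ω.meanEnergy (hubbardTTPrimeFermionInteraction t t' U) 1 + 2 * Real.binEntropy (n / 2) / β := by
  have hn0' : 0 ≤ n := hn0.le
  have hn2' : n ≤ 2 := hn2.le
  obtain ⟨φ, hφ, r, hr0, hr⟩ := hω.exists_tendsto_partitionFn_ratio_pos_of_pairCompanion t t' U β hn0 hn2 hLs hω''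
  have hLsφ : Tendsto (Ls ∘ φ) atTop atTop := hLs.comp hφ.tendsto_atTop
  refine le_of_forall_pos_le_add fun ε hε => ?_
  have hs : 2 * Real.binEntropy (n / 2) < 2 * Real.binEntropy (n / 2) + β * ε := by
    linarith [mul_pos hβ hε]
  have hev := eventually_log_card_spinConfig_pairCompanion_le hn0' hn2' hLsφ hs
  have hcap := InfVolFermionState.IsTorusLimitOfMixture.meanEnergy_le_meanEnergy_add_of_partitionRatio t t' U β hβ
    (fun L => szConfig n L) (fun L => spinConfig (Λ := FermionTorus 2 L) (halfRectN n L - 1) (halfRectN n L - 1))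
    (fun L s s' hs hs' => hubbardTorusTT'_apply_eq_zero_of_szConfig L t t' U n s s' hs hs')
    (fun L s s' hs hs' => hubbardTorusTT'_apply_eq_zero_of_spinConfig L t t' U _ _ s s' hs hs')
    (fun L => sectorGibbsIndex n L) (fun L => (Fintype.equivFin _).symm)
    (sectorGibbsWeightTT'_eq_canonicalWeight t t' U β n) (fun L i => rfl) (fun L i => rfl) (fun L i => rfl)
    hLsφ (hω.comp_tendsto hφ.tendsto_atTop) (hω''.comp_tendsto hφ.tendsto_atTop)
    (Eventually.of_forall fun j => by
      obtain ⟨s₀, hs₀⟩ := exists_szConfig hn0' hn2' (Ls (φ j))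
      exact ⟨⟨s₀, hs₀⟩⟩)
    (Eventually.of_forall fun j => by
      obtain ⟨s₁, hs₁⟩ := exists_spinConfig_of_le (Ls (φ j))
        ((Nat.sub_le _ _).trans (halfRectN_le_mul_self hn0' hn2' _))
        ((Nat.sub_le _ _).trans (halfRectN_le_mul_self hn0' hn2' _))
      exact ⟨⟨s₁, hs₁⟩⟩)
    hr0 hr hev
  have hsplit : (2 * Real.binEntropy (n / 2) + β * ε) / β = 2 * Real.binEntropy (n / 2) / β + ε := by
    rw [add_div, mul_div_assoc, mul_div_cancel_left₀ ε hβ.ne']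
  linarith [hcap, hsplit]

/-- **… and the lower side**: `e_Φ(ω) ≤ e_Φ(ω'') + 2·H_b(n/2)/β`. [cite: Israel1979, Lemma II.3.1]
[cite: BratteliRobinsonII1997, §5.4.2] [cite: Ruelle1969, §3.4] -/
theorem InfVolFermionState.IsTorusLimitOfMixture.meanEnergy_le_meanEnergy_pairCompanion_add
    (hβ : 0 < β) {n : ℝ} (hn0 : 0 < n) (hn2 : n < 2) {Ls : ℕ → ℕ} (hLs : Tendsto Ls atTop atTop)
    {ω ω'' : InfVolFermionState 2}
    (hω : ω.IsTorusLimitOfMixture (sectorGibbsCount n) (fun L => sectorGibbsWeightTT' β t t' U n L)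
      (fun L => sectorGibbsVectorTT' t t' U n L) Ls)
    (hω'' : ω''.IsTorusLimitOfMixture
      (fun L => Fintype.card (Subtype (spinConfig (Λ := FermionTorus 2 L) (halfRectN n L - 1) (halfRectN n L - 1))))
      (fun L i => canonicalWeight β (sectorEigenvalue (spinConfig (halfRectN n L - 1) (halfRectN n L - 1))
        (hubbardTorusTT' L t t' U) (hubbardTorusTT'_isHermitian L t t' U)) ((Fintype.equivFin _).symm i))
      (fun L i => sectorEigenvector (spinConfig (halfRectN n L - 1) (halfRectN n L - 1)) (hubbardTorusTT' L t t' U)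
        (hubbardTorusTT'_isHermitian L t t' U) ((Fintype.equivFin _).symm i)) Ls) :
    ω.meanEnergy (hubbardTTPrimeFermionInteraction t t' U) 1 ≤
      ω''.meanEnergy (hubbardTTPrimeFermionInteraction t t' U) 1 + 2 * Real.binEntropy (n / 2) / β := by
  have hn0' : 0 ≤ n := hn0.le
  have hn2' : n ≤ 2 := hn2.le
  obtain ⟨φ, hφ, r, hr0, hr⟩ := hω.exists_tendsto_partitionFn_ratio_pos_of_pairCompanion t t' U β hn0 hn2 hLs hω''
  have hLsφ : Tendsto (Ls ∘ φ) atTop atTop := hLs.comp hφ.tendsto_atTop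
  have hr' : Tendsto (fun j =>
      (∑ c, Real.exp (-(β * sectorEigenvalue (szConfig n (Ls (φ j))) (hubbardTorusTT' (Ls (φ j)) t t' U)
          (hubbardTorusTT'_isHermitian (Ls (φ j)) t t' U) c))) /
        ∑ d, Real.exp (-(β * sectorEigenvalue (spinConfig (halfRectN n (Ls (φ j)) - 1) (halfRectN n (Ls (φ j)) - 1))
          (hubbardTorusTT' (Ls (φ j)) t t' U) (hubbardTorusTT'_isHermitian (Ls (φ j)) t t' U) d))) atTop (𝓝 r⁻¹) := by
    refine (hr.inv₀ hr0.ne').congr fun j => ?_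
    rw [inv_div]
  refine le_of_forall_pos_le_add fun ε hε => ?_
  have hs : 2 * Real.binEntropy (n / 2) < 2 * Real.binEntropy (n / 2) + β * ε := by
    linarith [mul_pos hβ hε]
  have hev : ∀ᶠ j in atTop, Real.log (Fintype.card (Subtype (szConfig n ((Ls ∘ φ) j)))) ≤
      (2 * Real.binEntropy (n / 2) + β * ε) * (((Ls ∘ φ) j : ℕ) : ℝ) ^ 2 :=
    (hLsφ.eventually (eventually_log_sectorGibbsCount_le hn0' hn2' hs)).mono fun j hj => hj
  have hcap := InfVolFermionState.IsTorusLimitOfMixture.meanEnergy_le_meanEnergy_add_of_partitionRatio t t' U β hβ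
    (fun L => spinConfig (Λ := FermionTorus 2 L) (halfRectN n L - 1) (halfRectN n L - 1)) (fun L => szConfig n L)
    (fun L s s' hs hs' => hubbardTorusTT'_apply_eq_zero_of_spinConfig L t t' U _ _ s s' hs hs')
    (fun L s s' hs hs' => hubbardTorusTT'_apply_eq_zero_of_szConfig L t t' U n s s' hs hs')
    (fun L => (Fintype.equivFin _).symm) (fun L => sectorGibbsIndex n L)
    (fun L i => rfl) (fun L i => rfl) (sectorGibbsWeightTT'_eq_canonicalWeight t t' U β n) (fun L i => rfl)
    hLsφ (hω''.comp_tendsto hφ.tendsto_atTop) (hω.comp_tendsto hφ.tendsto_atTop)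
    (Eventually.of_forall fun j => by
      obtain ⟨s₁, hs₁⟩ := exists_spinConfig_of_le (Ls (φ j))
        ((Nat.sub_le _ _).trans (halfRectN_le_mul_self hn0' hn2' _))
        ((Nat.sub_le _ _).trans (halfRectN_le_mul_self hn0' hn2' _))
      exact ⟨⟨s₁, hs₁⟩⟩)
    (Eventually.of_forall fun j => by
      obtain ⟨s₀, hs₀⟩ := exists_szConfig hn0' hn2' (Ls (φ j))
      exact ⟨⟨s₀, hs₀⟩⟩)
    (inv_pos.2 hr0) hr' hev
  have hsplit : (2 * Real.binEntropy (n / 2) + β * ε) / β = 2 * Real.binEntropy (n / 2) / β + ε := by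
    rw [add_div, mul_div_assoc, mul_div_cancel_left₀ ε hβ.ne']
  linarith [hcap, hsplit]

/-- **Energy FLOOR for the pair companion**: `e(t,t',U,n) ≤ e_Φ(ω'')` (`U ≥ 0`, `0 < n < 2`; the pair companion is
translation invariant with density `n/2 + n/2 = n`). [cite: Ruelle1969, §3.4] -/
theorem InfVolFermionState.IsTorusLimitOfMixture.energyDensityTT'_le_meanEnergy_pairCompanion
    (hU : 0 ≤ U) {n : ℝ} (hn0 : 0 < n) (hn2 : n < 2) {Ls : ℕ → ℕ} (hLs : Tendsto Ls atTop atTop)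
    {ω'' : InfVolFermionState 2}
    (hω'' : ω''.IsTorusLimitOfMixture
      (fun L => Fintype.card (Subtype (spinConfig (Λ := FermionTorus 2 L) (halfRectN n L - 1) (halfRectN n L - 1))))
      (fun L i => canonicalWeight β (sectorEigenvalue (spinConfig (halfRectN n L - 1) (halfRectN n L - 1))
        (hubbardTorusTT' L t t' U) (hubbardTorusTT'_isHermitian L t t' U)) ((Fintype.equivFin _).symm i))
      (fun L i => sectorEigenvector (spinConfig (halfRectN n L - 1) (halfRectN n L - 1)) (hubbardTorusTT' L t t' U)
        (hubbardTorusTT'_isHermitian L t t' U) ((Fintype.equivFin _).symm i)) Ls) :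
    energyDensityTT' t t' U n ≤ ω''.meanEnergy (hubbardTTPrimeFermionInteraction t t' U) 1 := by
  have hρ : ω''.density = n := by
    rw [InfVolFermionState.density, InfVolFermionState.densityAt, map_add, Complex.add_re,
      hω''.re_expect_nAt_up_eq_half_of_pairCompanion t t' U β hn0.le hn2.le hLs,
      hω''.re_expect_nAt_down_eq_half_of_pairCompanion t t' U β hn0.le hn2.le hLs]
    ring
  exact InfVolFermionState.energyDensityTT'_le_meanEnergy_of_isTranslationInvariant t t' hU hn0 hn2
    hω''.isTranslationInvariant hρ

/-- **The pair companion's energy window, assembled** (`β > 0`, `U ≥ 0`, `0 < n < 2`):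
`e(t,t',U,n) ≤ e_Φ(ω'') ≤ e_Φ(ω) + 2·H_b(n/2)/β` — the variational floor and the relative cap; with the
record's N2′ cap (`…meanEnergy_hubbardTTPrime_le_energyDensityTT'_add_binEntropy_div`) or any certified cap on
`e_Φ(ω)` this is an absolute window for `ω''` (the sharp absolute cap `e(n) + 2H_b(n/2)/β`, proved for the
`(k − 1, k)` companion in `…CompanionEnergyWindow`, is not repeated here). [cite: Israel1979, Lemma II.3.1]
[cite: Ruelle1969, §3.4] -/
theorem InfVolFermionState.IsTorusLimitOfMixture.meanEnergy_pairCompanion_mem_Icc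
    (hβ : 0 < β) (hU : 0 ≤ U) {n : ℝ} (hn0 : 0 < n) (hn2 : n < 2) {Ls : ℕ → ℕ}
    (hLs : Tendsto Ls atTop atTop) {ω ω'' : InfVolFermionState 2}
    (hω : ω.IsTorusLimitOfMixture (sectorGibbsCount n) (fun L => sectorGibbsWeightTT' β t t' U n L)
      (fun L => sectorGibbsVectorTT' t t' U n L) Ls)
    (hω'' : ω''.IsTorusLimitOfMixture
      (fun L => Fintype.card (Subtype (spinConfig (Λ := FermionTorus 2 L) (halfRectN n L - 1) (halfRectN n L - 1))))
      (fun L i => canonicalWeight β (sectorEigenvalue (spinConfig (halfRectN n L - 1) (halfRectN n L - 1))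
        (hubbardTorusTT' L t t' U) (hubbardTorusTT'_isHermitian L t t' U)) ((Fintype.equivFin _).symm i))
      (fun L i => sectorEigenvector (spinConfig (halfRectN n L - 1) (halfRectN n L - 1)) (hubbardTorusTT' L t t' U)
        (hubbardTorusTT'_isHermitian L t t' U) ((Fintype.equivFin _).symm i)) Ls) :
    ω''.meanEnergy (hubbardTTPrimeFermionInteraction t t' U) 1 ∈
      Set.Icc (energyDensityTT' t t' U n)
        (ω.meanEnergy (hubbardTTPrimeFermionInteraction t t' U) 1 + 2 * Real.binEntropy (n / 2) / β) :=
  ⟨hω''.energyDensityTT'_le_meanEnergy_pairCompanion t t' U β hU hn0 hn2 hLs,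
    hω.meanEnergy_pairCompanion_le_meanEnergy_add t t' U β hβ hn0 hn2 hLs hω''⟩

end Windows

/-! ### §4 The record's N2′ cap transports to ANY companion family linked by a convergent ratio -/

section AbsoluteCap

variable (t t' U β : ℝ)

/-- **Absolute energy cap for a companion of the object of record (abstract family).** Let `ω` be the thermal
object of record along `Ls → ∞` (`β > 0`, `U ≥ 0`, `0 < n < 2`), `P'_L` a sector family of the torus (no matrix
elements of `H_L` leave it) with canonical eigen-data presented as `(m', p', ψ', e')`, `ω'` a torus limit of the
`P'`-mixtures along the same `Ls`, `P'` eventually nonempty, `Z_{P'}/Z_{(k,k)} → r > 0` and `log #P'_L ≤ s·L²`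
eventually. Then `e_Φ(ω') ≤ e(t,t',U,n) + s/β`: at finite volume `β⟨E'⟩ ≤ log #P' + β·E₀(L; rectN n L) − log(Z'/Z)`
(`F ≤ E₀`), `E₀/L² → e(n)`, `log(Z'/Z)/L² → 0`. [cite: Israel1979, Lemma II.3.1] [cite: Ruelle1969, §3.4]
[cite: BratteliRobinsonII1997, §5.4.2] -/
theorem InfVolFermionState.IsTorusLimitOfMixture.meanEnergy_companion_le_energyDensityTT'_add_of_partitionRatio
    (hβ : 0 < β) (hU : 0 ≤ U) {n : ℝ} (hn0 : 0 < n) (hn2 : n < 2)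
    (P' : ∀ L : ℕ, Finset (Orb (FermionTorus 2 L)) → Prop) [hdP' : ∀ L, DecidablePred (P' L)]
    (hP' : ∀ L s s', ¬ P' L s → P' L s' → hubbardTorusTT' L t t' U s s' = 0)
    {m' : ℕ → ℕ} {p' : ∀ L, Fin (m' L) → ℝ} {ψ' : ∀ L, Fin (m' L) → Fock (Orb (FermionTorus 2 L))}
    (e' : ∀ L, Fin (m' L) ≃ Subtype (P' L))
    (hp' : ∀ L i, p' L i = canonicalWeight β (sectorEigenvalue (P' L) (hubbardTorusTT' L t t' U)
      (hubbardTorusTT'_isHermitian L t t' U)) (e' L i))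
    (hψ' : ∀ L i, ψ' L i = sectorEigenvector (P' L) (hubbardTorusTT' L t t' U)
      (hubbardTorusTT'_isHermitian L t t' U) (e' L i))
    {Ls : ℕ → ℕ} (hLs : Tendsto Ls atTop atTop) {ω' : InfVolFermionState 2}
    (hω' : ω'.IsTorusLimitOfMixture m' p' ψ' Ls)
    (hne' : ∀ᶠ j in atTop, Nonempty (Subtype (P' (Ls j))))
    {r : ℝ} (hr0 : 0 < r) (hr : Tendsto (fun j =>
      (∑ d, Real.exp (-(β * sectorEigenvalue (P' (Ls j)) (hubbardTorusTT' (Ls j) t t' U)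
          (hubbardTorusTT'_isHermitian (Ls j) t t' U) d))) /
        ∑ c, Real.exp (-(β * sectorEigenvalue (szConfig n (Ls j)) (hubbardTorusTT' (Ls j) t t' U)
          (hubbardTorusTT'_isHermitian (Ls j) t t' U) c))) atTop (𝓝 r))
    {s : ℝ} (hS : ∀ᶠ j in atTop, Real.log (Fintype.card (Subtype (P' (Ls j)))) ≤ s * (Ls j : ℝ) ^ 2) :
    ω'.meanEnergy (hubbardTTPrimeFermionInteraction t t' U) 1 ≤ energyDensityTT' t t' U n + s / β := by
  have hn0' : 0 ≤ n := hn0.le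
  have hn2' : n ≤ 2 := hn2.le
  set R : ℕ → ℝ := fun j =>
    (∑ d, Real.exp (-(β * sectorEigenvalue (P' (Ls j)) (hubbardTorusTT' (Ls j) t t' U)
        (hubbardTorusTT'_isHermitian (Ls j) t t' U) d))) /
      ∑ c, Real.exp (-(β * sectorEigenvalue (szConfig n (Ls j)) (hubbardTorusTT' (Ls j) t t' U)
        (hubbardTorusTT'_isHermitian (Ls j) t t' U) c)) with hR
  have h1' := hω'.tendsto_meanEnergy_hubbardTTPrime t t' U hLs
  have he := (tendsto_energyDensityTT'_torus t t' hU hn0' hn2).comp hLs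
  have hlog : Tendsto (fun j => Real.log (R j) / (β * (Ls j : ℝ) ^ 2)) atTop (𝓝 0) := by
    have hnum : Tendsto (fun j => Real.log (R j)) atTop (𝓝 (Real.log r)) :=
      (Real.continuousAt_log hr0.ne').tendsto.comp hr
    have hden : Tendsto (fun j => β * (Ls j : ℝ) ^ 2) atTop atTop :=
      ((tendsto_pow_atTop two_ne_zero).comp (tendsto_natCast_atTop_atTop.comp hLs)).const_mul_atTop hβ
    exact hnum.div_atTop hden
  have h2 : Tendsto (fun j => groundEnergy (hubbardTorusTT' (Ls j) t t' U) (rectN n (Ls j)) / (Ls j : ℝ) ^ 2 +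
      s / β - Real.log (R j) / (β * (Ls j : ℝ) ^ 2)) atTop (𝓝 (energyDensityTT' t t' U n + s / β - 0)) :=
    (he.add_const (s / β)).sub hlog
  rw [sub_zero] at h2
  refine le_of_tendsto_of_tendsto h1' h2 ?_
  filter_upwards [hS, hne', hLs.eventually_ge_atTop 1] with j hSj hn' hj
  haveI : NeZero (Ls j) := ⟨by omega⟩
  haveI := hn'
  obtain ⟨s₀, hs₀⟩ := exists_szConfig hn0' hn2' (Ls j)
  haveI : Nonempty (Subtype (szConfig n (Ls j))) := ⟨⟨s₀, hs₀⟩⟩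
  have hL2 : (0 : ℝ) < (Ls j : ℝ) ^ 2 := by
    have : (1 : ℝ) ≤ Ls j := by exact_mod_cast hj
    positivity
  have hβL : (0 : ℝ) < β * (Ls j : ℝ) ^ 2 := mul_pos hβ hL2
  obtain ⟨c₀, hc₀⟩ := exists_sectorEigenvalue_szConfig_le_groundEnergy t t' U (Ls j) hn0' hn2'
  have key := mul_gibbsMean_le_level_of_partitionRatio β
    (sectorEigenvalue (szConfig n (Ls j)) (hubbardTorusTT' (Ls j) t t' U) (hubbardTorusTT'_isHermitian (Ls j) t t' U))
    (sectorEigenvalue (P' (Ls j)) (hubbardTorusTT' (Ls j) t t' U) (hubbardTorusTT'_isHermitian (Ls j) t t' U)) c₀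
  rw [← sum_presentation_mul_re_expect_eq_gibbsMean t t' U β (hP' (Ls j)) (e' (Ls j)) (hp' (Ls j)) (hψ' (Ls j))] at key
  set A := ∑ i, p' (Ls j) i * (QuantumLattice.expect (hubbardTorusTT' (Ls j) t t' U) (ψ' (Ls j) i)).re with hA
  have hsumA : ∑ i, p' (Ls j) i *
      ((QuantumLattice.expect (hubbardTorusTT' (Ls j) t t' U) (ψ' (Ls j) i)).re / (Ls j : ℝ) ^ 2) =
      A / (Ls j : ℝ) ^ 2 := by
    rw [hA, Finset.sum_div]
    refine Finset.sum_congr rfl fun i _ => ?_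
    ring
  rw [hsumA]
  have key' : β * A ≤ s * (Ls j : ℝ) ^ 2 +
      β * groundEnergy (hubbardTorusTT' (Ls j) t t' U) (rectN n (Ls j)) - Real.log (R j) := by
    rw [hR]
    nlinarith [mul_le_mul_of_nonneg_left hc₀ hβ.le, hSj, key]
  calc A / (Ls j : ℝ) ^ 2 = β * A / (β * (Ls j : ℝ) ^ 2) := by
        field_simp
    _ ≤ (s * (Ls j : ℝ) ^ 2 + β * groundEnergy (hubbardTorusTT' (Ls j) t t' U) (rectN n (Ls j)) -
          Real.log (R j)) / (β * (Ls j : ℝ) ^ 2) :=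
        div_le_div_of_nonneg_right key' hβL.le
    _ = groundEnergy (hubbardTorusTT' (Ls j) t t' U) (rectN n (Ls j)) / (Ls j : ℝ) ^ 2 + s / β -
          Real.log (R j) / (β * (Ls j : ℝ) ^ 2) := by
        field_simp
        ring

/-- **Energy CAP for the pair companion = the record N2′ cap, hypothesis-free** (`β > 0`, `U ≥ 0`, `0 < n < 2`):
for the thermal object of record `ω` along `Ls` and ANY torus limit `ω''` along the same `Ls` of the canonical
states of the pair sectors `(k_L − 1, k_L − 1)`: `e_Φ(ω'') ≤ e(t,t',U,n) + 2·H_b(n/2)/β`.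
[cite: Israel1979, Lemma II.3.1] [cite: Ruelle1969, §3.4] -/
theorem InfVolFermionState.IsTorusLimitOfMixture.meanEnergy_pairCompanion_le_energyDensityTT'_add
    (hβ : 0 < β) (hU : 0 ≤ U) {n : ℝ} (hn0 : 0 < n) (hn2 : n < 2) {Ls : ℕ → ℕ}
    (hLs : Tendsto Ls atTop atTop) {ω ω'' : InfVolFermionState 2}
    (hω : ω.IsTorusLimitOfMixture (sectorGibbsCount n) (fun L => sectorGibbsWeightTT' β t t' U n L)
      (fun L => sectorGibbsVectorTT' t t' U n L) Ls)
    (hω'' : ω''.IsTorusLimitOfMixture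
      (fun L => Fintype.card (Subtype (spinConfig (Λ := FermionTorus 2 L) (halfRectN n L - 1) (halfRectN n L - 1))))
      (fun L i => canonicalWeight β (sectorEigenvalue (spinConfig (halfRectN n L - 1) (halfRectN n L - 1))
        (hubbardTorusTT' L t t' U) (hubbardTorusTT'_isHermitian L t t' U)) ((Fintype.equivFin _).symm i))
      (fun L i => sectorEigenvector (spinConfig (halfRectN n L - 1) (halfRectN n L - 1)) (hubbardTorusTT' L t t' U)
        (hubbardTorusTT'_isHermitian L t t' U) ((Fintype.equivFin _).symm i)) Ls) :
    ω''.meanEnergy (hubbardTTPrimeFermionInteraction t t' U) 1 ≤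
      energyDensityTT' t t' U n + 2 * Real.binEntropy (n / 2) / β := by
  have hn0' : 0 ≤ n := hn0.le
  have hn2' : n ≤ 2 := hn2.le
  obtain ⟨φ, hφ, r, hr0, hr⟩ := hω.exists_tendsto_partitionFn_ratio_pos_of_pairCompanion t t' U β hn0 hn2 hLs hω''
  have hLsφ : Tendsto (Ls ∘ φ) atTop atTop := hLs.comp hφ.tendsto_atTop
  refine le_of_forall_pos_le_add fun ε hε => ?_
  have hs : 2 * Real.binEntropy (n / 2) < 2 * Real.binEntropy (n / 2) + β * ε := by
    linarith [mul_pos hβ hε]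
  have hev := eventually_log_card_spinConfig_pairCompanion_le hn0' hn2' hLsφ hs
  have hcap := InfVolFermionState.IsTorusLimitOfMixture.meanEnergy_companion_le_energyDensityTT'_add_of_partitionRatio
    t t' U β hβ hU hn0 hn2
    (fun L => spinConfig (Λ := FermionTorus 2 L) (halfRectN n L - 1) (halfRectN n L - 1))
    (fun L s s' hs hs' => hubbardTorusTT'_apply_eq_zero_of_spinConfig L t t' U _ _ s s' hs hs')
    (fun L => (Fintype.equivFin _).symm) (fun L i => rfl) (fun L i => rfl) hLsφ
    (hω''.comp_tendsto hφ.tendsto_atTop)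
    (Eventually.of_forall fun j => by
      obtain ⟨s₁, hs₁⟩ := exists_spinConfig_of_le (Ls (φ j))
        ((Nat.sub_le _ _).trans (halfRectN_le_mul_self hn0' hn2' _))
        ((Nat.sub_le _ _).trans (halfRectN_le_mul_self hn0' hn2' _))
      exact ⟨⟨s₁, hs₁⟩⟩)
    hr0 hr hev
  have hsplit : (2 * Real.binEntropy (n / 2) + β * ε) / β = 2 * Real.binEntropy (n / 2) / β + ε := by
    rw [add_div, mul_div_assoc, mul_div_cancel_left₀ ε hβ.ne']
  linarith [hcap, hsplit]

/-- **The pair companion obeys EXACTLY the record N2′ window** (`β > 0`, `U ≥ 0`, `0 < n < 2`):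
`e(n) ≤ e_Φ(ω'') ≤ e(n) + 2·H_b(n/2)/β` — so every `T = 0` filling-box energy row transports to the pair
companion classes verbatim. [cite: Israel1979, Lemma II.3.1] [cite: Ruelle1969, §3.4] -/
theorem InfVolFermionState.IsTorusLimitOfMixture.meanEnergy_pairCompanion_mem_Icc_energyDensityTT'
    (hβ : 0 < β) (hU : 0 ≤ U) {n : ℝ} (hn0 : 0 < n) (hn2 : n < 2) {Ls : ℕ → ℕ}
    (hLs : Tendsto Ls atTop atTop) {ω ω'' : InfVolFermionState 2}
    (hω : ω.IsTorusLimitOfMixture (sectorGibbsCount n) (fun L => sectorGibbsWeightTT' β t t' U n L)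
      (fun L => sectorGibbsVectorTT' t t' U n L) Ls)
    (hω'' : ω''.IsTorusLimitOfMixture
      (fun L => Fintype.card (Subtype (spinConfig (Λ := FermionTorus 2 L) (halfRectN n L - 1) (halfRectN n L - 1))))
      (fun L i => canonicalWeight β (sectorEigenvalue (spinConfig (halfRectN n L - 1) (halfRectN n L - 1))
        (hubbardTorusTT' L t t' U) (hubbardTorusTT'_isHermitian L t t' U)) ((Fintype.equivFin _).symm i))
      (fun L i => sectorEigenvector (spinConfig (halfRectN n L - 1) (halfRectN n L - 1)) (hubbardTorusTT' L t t' U)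
        (hubbardTorusTT'_isHermitian L t t' U) ((Fintype.equivFin _).symm i)) Ls) :
    ω''.meanEnergy (hubbardTTPrimeFermionInteraction t t' U) 1 ∈
      Set.Icc (energyDensityTT' t t' U n) (energyDensityTT' t t' U n + 2 * Real.binEntropy (n / 2) / β) :=
  ⟨hω''.energyDensityTT'_le_meanEnergy_pairCompanion t t' U β hU hn0 hn2 hLs,
    hω.meanEnergy_pairCompanion_le_energyDensityTT'_add t t' U β hβ hU hn0 hn2 hLs hω''⟩

end AbsoluteCap

end Literature.MathematicalPhysics.QuantumLattice

end
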